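import Mathlib
import Literature.Computability.AlgebraicComplexity.GroupTheoreticMatMul
import Literature.Computability.AlgebraicComplexity.STPPLineFamilies
import Literature.Combinatorics.Additive.TightTriangleRemovalProofs

/-!
# The CKSU punctured pair over ARBITRARY factor groups `K₁ × K₂ × K₃` admits no third member (cell mm-stpp, eng-1 g7)

Companion of `AbelianSTPPCensusPuncturedSubgroupsPair.lean` (the pair `(P₀,P₁,P₂), (P₁,P₂,P₀)` of punctured
coordinate subgroups of `K₁ × K₂ × K₃` IS an `IsSTPP` family for any three additive groups) and the
factor-general form of the tree's `Prop52Maximal.prop52_pair_maximal` (host `(ℤ/n)³`, `n ≥ 3`):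
**if in each factor every element is a sum of two non-zero elements (equivalently `|Kᵢ| ≥ 3`, or `Kᵢ`
infinite), then no triple `(A₃, B₃, C₃)` of non-empty sets makes `![P₀, P₁, A₃], ![P₁, P₂, B₃], ![P₂, P₀, C₃]`
an `IsSTPP` family** (`not_isSTPP_puncturedSubgroups_pair_third`), and consequently an `IsSTPP` family that
contains the pair at two indices has `A l = ∅ ∨ B l = ∅ ∨ C l = ∅` at every other index `l`
(`empty_of_isSTPP_contains_pair`).  This is the cell's conjecture (MAX) «a CKSU pair is maximal» for EVERY
CKSU design — all hosts of the census's fat pairs: `ℤ/5³`, `ℤ/6³`, `ℤ/7³`, the ten three-factor 2-groups of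
order 512 (`K = ℤ/8`, `ℤ/4 × ℤ/2`, `(ℤ/2)³`), the coprime-cyclic hosts `ℤ/140 ≅ ℤ/4 × ℤ/5 × ℤ/7`,
`ℤ/210`, and the mixed designs at `144, 150, 168, 175, 180, 196` — where the `(ℤ/n)³` theorem does not apply.
(A FAT pair, `2|A||B||C| > |G|`, sits in no proper over-group of `K₁ ⊕ K₂ ⊕ K₃` by index, so for fat CKSU
designs this is (MAX) in every abelian host: `empty_of_isSTPP_contains_fat_frame`, rev. 2 — an injective
`f : K₁ × K₂ × K₃ →+ G` with `|G| < 2|K₁||K₂||K₃|` is onto by Lagrange, and the family pulls back along the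
inverse isomorphism.)

Proof (pencil, this seat; the same residual test as the planner's for `(ℤ/n)³`): write `d = a − b`,
`e = b − c`, `f = c − a` for `a ∈ A₃, b ∈ B₃, c ∈ C₃`.  Six of the nine index patterns of CKSU Def. 5.1 (ii)
with exactly one index `2` give, coordinate-wise, `d.2 ≠ 0` (pattern `(2,1,0)`), hence `d.1 = 0`
(`(2,0,0)`); `e.3 ≠ 0` (`(0,2,1)`), hence `e.1 = 0` (`(1,2,1)`); and `f.1 ≠ 0` (`(1,0,2)`); but
`d + e + f = 0`.  Each pattern is realised by choosing the pair's witnesses coordinate by coordinate, which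
needs exactly «every element of `Kᵢ` is a sum (hence also a difference) of two non-zero elements».

WHAT THIS IS NOT: no `ω` statement, no census number; a structural negative about ONE seed pair per host.

## References
* H. Cohn, R. Kleinberg, B. Szegedy, C. Umans, FOCS 2005, Def. 5.1, Prop. 5.2.
-/

-- single-conjunct summit: the mandated namespace repeats `MatrixMultiplication`.
set_option linter.dupNamespace false

namespace Summit.MatrixMultiplication.MatrixMultiplication.Theorems.STPPPuncturedSubgroupsMaximal

open Finset
open Literature.Computability.AlgebraicComplexity (IsSTPP)

variable {K₁ K₂ K₃ : Type*} [AddCommGroup K₁] [AddCommGroup K₂] [AddCommGroup K₃]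
  {P₀ P₁ P₂ : Finset (K₁ × K₂ × K₃)}

/-- In an additive group in which every element is a sum of two non-zero elements, every element is also a
difference of two non-zero elements. [bookkeeping] -/
theorem exists_sub_eq_of_exists_add_eq {K : Type*} [AddCommGroup K]
    (hK : ∀ x : K, ∃ y z : K, y ≠ 0 ∧ z ≠ 0 ∧ y + z = x) (x : K) :
    ∃ y z : K, y ≠ 0 ∧ z ≠ 0 ∧ y - z = x := by
  obtain ⟨y, z, hy, hz, h⟩ := hK x
  exact ⟨y, -z, hy, neg_ne_zero.mpr hz, by rw [sub_neg_eq_add, h]⟩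

/-- A finite additive group with at least three elements: every element is a sum of two non-zero elements
(`0 = y + (−y)` with `y ≠ 0`; `x ≠ 0`: `x = y + (x − y)` with `y ∉ {0, x}`). [bookkeeping] -/
theorem exists_add_eq_of_two_lt_card {K : Type*} [AddCommGroup K] [Fintype K] [DecidableEq K]
    (hK : 2 < Fintype.card K) (x : K) : ∃ y z : K, y ≠ 0 ∧ z ≠ 0 ∧ y + z = x := by
  -- a non-zero element `y` different from `x`
  have hcard : 2 < (univ : Finset K).card := by rwa [card_univ]
  have h3 : ((univ : Finset K).erase 0).erase x ≠ ∅ := by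
    intro h
    have h1 : (((univ : Finset K).erase 0).erase x).card = 0 := by rw [h]; rfl
    have h2 : ((univ : Finset K).erase 0).card - 1 ≤ (((univ : Finset K).erase 0).erase x).card :=
      pred_card_le_card_erase
    have h4 : (univ : Finset K).card - 1 ≤ ((univ : Finset K).erase 0).card := pred_card_le_card_erase
    omega
  obtain ⟨y, hy⟩ := nonempty_iff_ne_empty.mpr h3
  rw [mem_erase, mem_erase] at hy
  obtain ⟨hyx, hy0, -⟩ := hy
  refine ⟨y, x - y, hy0, sub_ne_zero.mpr (Ne.symm hyx), by abel⟩

/-- **The CKSU punctured pair over arbitrary factors admits no third member.**  Host `K₁ × K₂ × K₃`, in each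
factor every element a sum of two non-zero elements; `P₀, P₁, P₂` the punctured coordinate subgroups
(membership hypotheses); indices `0 = (P₀,P₁,P₂)`, `1 = (P₁,P₂,P₀)`, `2 = (A₃,B₃,C₃)` arbitrary.  If the three
together are `IsSTPP` then one of `A₃, B₃, C₃` is empty.  (Factor-general form of
`Prop52Maximal.prop52_pair_maximal`; pencil proof in the module docstring.)
[cite: CohnKleinbergSzegedyUmans2005, Def. 5.1 and Prop. 5.2] -/
theorem not_isSTPP_puncturedSubgroups_pair_third
    (hK₁ : ∀ x : K₁, ∃ y z : K₁, y ≠ 0 ∧ z ≠ 0 ∧ y + z = x)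
    (hK₂ : ∀ x : K₂, ∃ y z : K₂, y ≠ 0 ∧ z ≠ 0 ∧ y + z = x)
    (hK₃ : ∀ x : K₃, ∃ y z : K₃, y ≠ 0 ∧ z ≠ 0 ∧ y + z = x)
    (hP₀ : ∀ v, v ∈ P₀ ↔ v.1 ≠ 0 ∧ v.2.1 = 0 ∧ v.2.2 = 0)
    (hP₁ : ∀ v, v ∈ P₁ ↔ v.2.1 ≠ 0 ∧ v.1 = 0 ∧ v.2.2 = 0)
    (hP₂ : ∀ v, v ∈ P₂ ↔ v.2.2 ≠ 0 ∧ v.1 = 0 ∧ v.2.1 = 0)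
    {A₃ B₃ C₃ : Finset (K₁ × K₂ × K₃)}
    (hA : A₃.Nonempty) (hB : B₃.Nonempty) (hC : C₃.Nonempty) :
    ¬ IsSTPP ![P₀, P₁, A₃] ![P₁, P₂, B₃] ![P₂, P₀, C₃] := by
  intro hS
  obtain ⟨a, ha⟩ := hA
  obtain ⟨b, hb⟩ := hB
  obtain ⟨c, hc⟩ := hC
  -- memberships in the family `![P₀, P₁, A₃], ![P₁, P₂, B₃], ![P₂, P₀, C₃]`
  have mA0 : ∀ x : K₁, x ≠ 0 → ((x, 0, 0) : K₁ × K₂ × K₃) ∈ ![P₀, P₁, A₃] 0 :=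
    fun x hx => (hP₀ _).2 ⟨hx, rfl, rfl⟩
  have mA1 : ∀ y : K₂, y ≠ 0 → ((0, y, 0) : K₁ × K₂ × K₃) ∈ ![P₀, P₁, A₃] 1 :=
    fun y hy => (hP₁ _).2 ⟨hy, rfl, rfl⟩
  have mA2 : a ∈ ![P₀, P₁, A₃] 2 := ha
  have mB0 : ∀ y : K₂, y ≠ 0 → ((0, y, 0) : K₁ × K₂ × K₃) ∈ ![P₁, P₂, B₃] 0 :=
    fun y hy => (hP₁ _).2 ⟨hy, rfl, rfl⟩
  have mB1 : ∀ z : K₃, z ≠ 0 → ((0, 0, z) : K₁ × K₂ × K₃) ∈ ![P₁, P₂, B₃] 1 :=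
    fun z hz => (hP₂ _).2 ⟨hz, rfl, rfl⟩
  have mB2 : b ∈ ![P₁, P₂, B₃] 2 := hb
  have mC0 : ∀ z : K₃, z ≠ 0 → ((0, 0, z) : K₁ × K₂ × K₃) ∈ ![P₂, P₀, C₃] 0 :=
    fun z hz => (hP₂ _).2 ⟨hz, rfl, rfl⟩
  have mC1 : ∀ x : K₁, x ≠ 0 → ((x, 0, 0) : K₁ × K₂ × K₃) ∈ ![P₂, P₀, C₃] 1 :=
    fun x hx => (hP₀ _).2 ⟨hx, rfl, rfl⟩
  have mC2 : c ∈ ![P₂, P₀, C₃] 2 := hc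
  have h21 : ¬ ((2 : Fin 3) = 1) := by decide
  have h20 : ¬ ((2 : Fin 3) = 0) := by decide
  have h02 : ¬ ((0 : Fin 3) = 2) := by decide
  have h12 : ¬ ((1 : Fin 3) = 2) := by decide
  have h10 : ¬ ((1 : Fin 3) = 0) := by decide
  -- Step 1: `a.2.1 ≠ b.2.1`, pattern `(2,1,0)`:
  --   `s ∈ A 0`, `s' = a ∈ A 2`, `t = b ∈ B 2`, `t' ∈ B 1`, `u ∈ C 1`, `u' ∈ C 0`.
  have d2 : a.2.1 ≠ b.2.1 := by
    intro hd
    obtain ⟨x₁, x₂, hx₁, hx₂, hx⟩ := hK₁ (a.1 - b.1)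
    obtain ⟨z₁, z₂, hz₁, hz₂, hz⟩ := hK₃ (b.2.2 - a.2.2)
    have hx' : x₂ = a.1 - b.1 - x₁ := by rw [← hx]; abel
    have hz' : z₂ = b.2.2 - a.2.2 - z₁ := by rw [← hz]; abel
    subst hx' hz'
    have key := hS 2 1 0 (x₁, 0, 0) (mA0 x₁ hx₁) a mA2 b mB2 (0, 0, z₁) (mB1 z₁ hz₁)
      (a.1 - b.1 - x₁, 0, 0) (mC1 _ hx₂) (0, 0, b.2.2 - a.2.2 - z₁) (mC0 _ hz₂)
      (by
        refine Prod.ext ?_ (Prod.ext ?_ ?_) <;>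
          simp only [Prod.fst_add, Prod.fst_sub, Prod.fst_zero, Prod.snd_add, Prod.snd_sub,
            Prod.snd_zero]
        · abel
        · rw [hd]; abel
        · abel)
    exact h21 key.1
  -- Step 2: `a.1 = b.1`, pattern `(2,0,0)`:
  --   `s ∈ A 0`, `s' = a`, `t = b`, `t' ∈ B 0`, `u ∈ C 0`, `u' ∈ C 0`.
  have d1 : a.1 = b.1 := by
    by_contra hd
    have hx : a.1 - b.1 ≠ 0 := sub_ne_zero.mpr hd
    have hy : b.2.1 - a.2.1 ≠ 0 := sub_ne_zero.mpr (Ne.symm d2)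
    obtain ⟨z₁, z₂, hz₁, hz₂, hz⟩ := exists_sub_eq_of_exists_add_eq hK₃ (b.2.2 - a.2.2)
    have hz' : z₁ = b.2.2 - a.2.2 + z₂ := by rw [← hz]; abel
    subst hz'
    have key := hS 2 0 0 (a.1 - b.1, 0, 0) (mA0 _ hx) a mA2 b mB2 (0, b.2.1 - a.2.1, 0) (mB0 _ hy)
      (0, 0, z₂) (mC0 _ hz₂) (0, 0, b.2.2 - a.2.2 + z₂) (mC0 _ hz₁)
      (by
        refine Prod.ext ?_ (Prod.ext ?_ ?_) <;>
          simp only [Prod.fst_add, Prod.fst_sub, Prod.fst_zero, Prod.snd_add, Prod.snd_sub,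
            Prod.snd_zero] <;> abel)
    exact h20 key.1
  -- Step 3: `b.2.2 ≠ c.2.2`, pattern `(0,2,1)`:
  --   `s ∈ A 1`, `s' ∈ A 0`, `t ∈ B 0`, `t' = b ∈ B 2`, `u = c ∈ C 2`, `u' ∈ C 1`.
  have e3 : b.2.2 ≠ c.2.2 := by
    intro he
    obtain ⟨x₁, x₂, hx₁, hx₂, hx⟩ := hK₁ (c.1 - b.1)
    obtain ⟨y₁, y₂, hy₁, hy₂, hy⟩ := hK₂ (b.2.1 - c.2.1)
    have hx' : x₂ = c.1 - b.1 - x₁ := by rw [← hx]; abel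
    have hy' : y₂ = b.2.1 - c.2.1 - y₁ := by rw [← hy]; abel
    subst hx' hy'
    have key := hS 0 2 1 (0, y₁, 0) (mA1 y₁ hy₁) (x₁, 0, 0) (mA0 x₁ hx₁)
      (0, b.2.1 - c.2.1 - y₁, 0) (mB0 _ hy₂) b mB2 c mC2 (c.1 - b.1 - x₁, 0, 0) (mC1 _ hx₂)
      (by
        refine Prod.ext ?_ (Prod.ext ?_ ?_) <;>
          simp only [Prod.fst_add, Prod.fst_sub, Prod.fst_zero, Prod.snd_add, Prod.snd_sub,
            Prod.snd_zero]
        · abel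
        · abel
        · rw [he]; abel)
    exact h02 key.1
  -- Step 4: `b.1 = c.1`, pattern `(1,2,1)`:
  --   `s ∈ A 1`, `s' ∈ A 1`, `t ∈ B 1`, `t' = b`, `u = c`, `u' ∈ C 1`.
  have e1 : b.1 = c.1 := by
    by_contra he
    have hx : c.1 - b.1 ≠ 0 := sub_ne_zero.mpr (Ne.symm he)
    have hz : b.2.2 - c.2.2 ≠ 0 := sub_ne_zero.mpr e3
    obtain ⟨y₁, y₂, hy₁, hy₂, hy⟩ := exists_sub_eq_of_exists_add_eq hK₂ (c.2.1 - b.2.1)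
    have hy' : y₁ = c.2.1 - b.2.1 + y₂ := by rw [← hy]; abel
    subst hy'
    have key := hS 1 2 1 (0, y₂, 0) (mA1 _ hy₂) (0, c.2.1 - b.2.1 + y₂, 0) (mA1 _ hy₁)
      (0, 0, b.2.2 - c.2.2) (mB1 _ hz) b mB2 c mC2 (c.1 - b.1, 0, 0) (mC1 _ hx)
      (by
        refine Prod.ext ?_ (Prod.ext ?_ ?_) <;>
          simp only [Prod.fst_add, Prod.fst_sub, Prod.fst_zero, Prod.snd_add, Prod.snd_sub,
            Prod.snd_zero] <;> abel)
    exact h12 key.1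
  -- Step 5: `c.1 ≠ a.1`, pattern `(1,0,2)`:
  --   `s = a ∈ A 2`, `s' ∈ A 1`, `t ∈ B 1`, `t' ∈ B 0`, `u ∈ C 0`, `u' = c ∈ C 2`.
  have f1 : c.1 ≠ a.1 := by
    intro hf
    obtain ⟨y₁, y₂, hy₁, hy₂, hy⟩ := hK₂ (a.2.1 - c.2.1)
    obtain ⟨z₁, z₂, hz₁, hz₂, hz⟩ := hK₃ (c.2.2 - a.2.2)
    have hy' : y₂ = a.2.1 - c.2.1 - y₁ := by rw [← hy]; abel
    have hz' : z₂ = c.2.2 - a.2.2 - z₁ := by rw [← hz]; abel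
    subst hy' hz'
    have key := hS 1 0 2 a mA2 (0, y₁, 0) (mA1 y₁ hy₁) (0, 0, z₁) (mB1 z₁ hz₁)
      (0, a.2.1 - c.2.1 - y₁, 0) (mB0 _ hy₂) (0, 0, c.2.2 - a.2.2 - z₁) (mC0 _ hz₂) c mC2
      (by
        refine Prod.ext ?_ (Prod.ext ?_ ?_) <;>
          simp only [Prod.fst_add, Prod.fst_sub, Prod.fst_zero, Prod.snd_add, Prod.snd_sub,
            Prod.snd_zero]
        · rw [hf]; abel
        · abel
        · abel)
    exact h10 key.1
  exact f1 (by rw [← e1, ← d1])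

/-- **(MAX) for every CKSU design, finite form.**  For finite factors with at least three elements each, and
the punctured subgroups given as `filter`s, no non-empty third triple extends the pair.
[cite: CohnKleinbergSzegedyUmans2005, Def. 5.1 and Prop. 5.2] -/
theorem not_isSTPP_puncturedSubgroups_pair_third_of_card [Fintype K₁] [Fintype K₂] [Fintype K₃]
    [DecidableEq K₁] [DecidableEq K₂] [DecidableEq K₃]
    (h₁ : 2 < Fintype.card K₁) (h₂ : 2 < Fintype.card K₂) (h₃ : 2 < Fintype.card K₃)
    {A₃ B₃ C₃ : Finset (K₁ × K₂ × K₃)}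
    (hA : A₃.Nonempty) (hB : B₃.Nonempty) (hC : C₃.Nonempty) :
    ¬ IsSTPP
      ![univ.filter (fun v : K₁ × K₂ × K₃ => v.1 ≠ 0 ∧ v.2.1 = 0 ∧ v.2.2 = 0),
        univ.filter (fun v : K₁ × K₂ × K₃ => v.2.1 ≠ 0 ∧ v.1 = 0 ∧ v.2.2 = 0), A₃]
      ![univ.filter (fun v : K₁ × K₂ × K₃ => v.2.1 ≠ 0 ∧ v.1 = 0 ∧ v.2.2 = 0),
        univ.filter (fun v : K₁ × K₂ × K₃ => v.2.2 ≠ 0 ∧ v.1 = 0 ∧ v.2.1 = 0), B₃]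
      ![univ.filter (fun v : K₁ × K₂ × K₃ => v.2.2 ≠ 0 ∧ v.1 = 0 ∧ v.2.1 = 0),
        univ.filter (fun v : K₁ × K₂ × K₃ => v.1 ≠ 0 ∧ v.2.1 = 0 ∧ v.2.2 = 0), C₃] :=
  not_isSTPP_puncturedSubgroups_pair_third (exists_add_eq_of_two_lt_card h₁)
    (exists_add_eq_of_two_lt_card h₂) (exists_add_eq_of_two_lt_card h₃)
    (fun v => by simp) (fun v => by simp) (fun v => by simp) hA hB hC

/-- **A family containing the CKSU pair has an empty set at every other index.**  If an `IsSTPP` family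
`(A, B, C)` on `N` indices carries the punctured pair at two indices `j, k` (`A j = P₀, B j = P₁, C j = P₂`,
`A k = P₁, B k = P₂, C k = P₀`) then at every index `l ∉ {j, k}` one of `A l, B l, C l` is empty
(sub-families of STPP families are STPP, `IsSTPP.comp_of_injective`).
[cite: CohnKleinbergSzegedyUmans2005, Def. 5.1 and Prop. 5.2] -/
theorem empty_of_isSTPP_contains_pair
    (hK₁ : ∀ x : K₁, ∃ y z : K₁, y ≠ 0 ∧ z ≠ 0 ∧ y + z = x)
    (hK₂ : ∀ x : K₂, ∃ y z : K₂, y ≠ 0 ∧ z ≠ 0 ∧ y + z = x)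
    (hK₃ : ∀ x : K₃, ∃ y z : K₃, y ≠ 0 ∧ z ≠ 0 ∧ y + z = x)
    (hP₀ : ∀ v, v ∈ P₀ ↔ v.1 ≠ 0 ∧ v.2.1 = 0 ∧ v.2.2 = 0)
    (hP₁ : ∀ v, v ∈ P₁ ↔ v.2.1 ≠ 0 ∧ v.1 = 0 ∧ v.2.2 = 0)
    (hP₂ : ∀ v, v ∈ P₂ ↔ v.2.2 ≠ 0 ∧ v.1 = 0 ∧ v.2.1 = 0)
    {N : ℕ} {A B C : Fin N → Finset (K₁ × K₂ × K₃)} (hS : IsSTPP A B C)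
    {j k l : Fin N} (hlj : l ≠ j) (hlk : l ≠ k)
    (hAj : A j = P₀) (hBj : B j = P₁) (hCj : C j = P₂)
    (hAk : A k = P₁) (hBk : B k = P₂) (hCk : C k = P₀) :
    A l = ∅ ∨ B l = ∅ ∨ C l = ∅ := by
  have hjk : j ≠ k := by
    rintro rfl
    -- then `P₀ = P₁`; but `P₀` contains no element of `P₁`: take a non-zero `x : K₁` (from `hK₁ 0`)
    obtain ⟨y, z, hy, -, -⟩ := hK₁ 0
    have h1 : ((y, 0, 0) : K₁ × K₂ × K₃) ∈ P₀ := (hP₀ _).2 ⟨hy, rfl, rfl⟩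
    rw [← hAj, hAk, hP₁] at h1
    exact h1.1 rfl
  rcases (A l).eq_empty_or_nonempty with hAl | hAl
  · exact Or.inl hAl
  rcases (B l).eq_empty_or_nonempty with hBl | hBl
  · exact Or.inr (Or.inl hBl)
  rcases (C l).eq_empty_or_nonempty with hCl | hCl
  · exact Or.inr (Or.inr hCl)
  exfalso
  let ι : Fin 3 → Fin N := ![j, k, l]
  have hι : Function.Injective ι := by
    intro p q hpq
    fin_cases p <;> fin_cases q <;> simp [ι] at hpq ⊢ <;>
      first
        | exact hjk hpq
        | exact hjk hpq.symm
        | exact hlj hpq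
        | exact hlj hpq.symm
        | exact hlk hpq
        | exact hlk hpq.symm
  have hsub := hS.comp_of_injective ι hι
  have eA : (fun i => A (ι i)) = ![P₀, P₁, A l] := by
    funext i; fin_cases i <;> simp [ι, hAj, hAk]
  have eB : (fun i => B (ι i)) = ![P₁, P₂, B l] := by
    funext i; fin_cases i <;> simp [ι, hBj, hBk]
  have eC : (fun i => C (ι i)) = ![P₂, P₀, C l] := by
    funext i; fin_cases i <;> simp [ι, hCj, hCk]
  rw [eA, eB, eC] at hsub
  exact not_isSTPP_puncturedSubgroups_pair_third hK₁ hK₂ hK₃ hP₀ hP₁ hP₂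
    hAl hBl hCl hsub

/-- **(MAX) in every abelian host, for FAT frames.**  Let `f : K₁ × K₂ × K₃ →+ G` be injective into a
finite abelian group with `|G| < 2·|K₁||K₂||K₃|` (this holds whenever the pushed-forward CKSU pair is FAT in
`G`, i.e. `2·∏(|Kᵢ|−1) > |G|`).  Then `f` is onto (Lagrange: `|K₁||K₂||K₃|` divides `|G|`), and an `IsSTPP`
family in `G` carrying the pushed-forward punctured pair `f(P₀), f(P₁), f(P₂)` at two indices `j, k` has an
empty set at every other index (pull the family back along the inverse isomorphism and apply
`empty_of_isSTPP_contains_pair`). [cite: CohnKleinbergSzegedyUmans2005, Def. 5.1 and Prop. 5.2] -/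
theorem empty_of_isSTPP_contains_fat_frame {G : Type*} [AddCommGroup G] [Finite G] [DecidableEq G]
    [DecidableEq K₁] [DecidableEq K₂] [DecidableEq K₃]
    (hK₁ : ∀ x : K₁, ∃ y z : K₁, y ≠ 0 ∧ z ≠ 0 ∧ y + z = x)
    (hK₂ : ∀ x : K₂, ∃ y z : K₂, y ≠ 0 ∧ z ≠ 0 ∧ y + z = x)
    (hK₃ : ∀ x : K₃, ∃ y z : K₃, y ≠ 0 ∧ z ≠ 0 ∧ y + z = x)
    (hP₀ : ∀ v, v ∈ P₀ ↔ v.1 ≠ 0 ∧ v.2.1 = 0 ∧ v.2.2 = 0)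
    (hP₁ : ∀ v, v ∈ P₁ ↔ v.2.1 ≠ 0 ∧ v.1 = 0 ∧ v.2.2 = 0)
    (hP₂ : ∀ v, v ∈ P₂ ↔ v.2.2 ≠ 0 ∧ v.1 = 0 ∧ v.2.1 = 0)
    (f : K₁ × K₂ × K₃ →+ G) (hf : Function.Injective f)
    (hfat : Nat.card G < 2 * Nat.card (K₁ × K₂ × K₃))
    {N : ℕ} {A B C : Fin N → Finset G} (hS : IsSTPP A B C)
    {j k l : Fin N} (hlj : l ≠ j) (hlk : l ≠ k)
    (hAj : A j = P₀.image f) (hBj : B j = P₁.image f) (hCj : C j = P₂.image f)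
    (hAk : A k = P₁.image f) (hBk : B k = P₂.image f) (hCk : C k = P₀.image f) :
    A l = ∅ ∨ B l = ∅ ∨ C l = ∅ := by
  classical
  -- Lagrange: `|K| ∣ |G|`, and `|G| < 2|K|` forces `|G| = |K|`, so `f` is a bijection
  have hcardK : Nat.card f.range = Nat.card (K₁ × K₂ × K₃) :=
    (Nat.card_congr (AddMonoidHom.ofInjective hf).toEquiv).symm
  have hdvd : Nat.card (K₁ × K₂ × K₃) ∣ Nat.card G := by
    rw [← hcardK]; exact AddSubgroup.card_addSubgroup_dvd_card f.range
  obtain ⟨m, hm⟩ := hdvd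
  have hGpos : 0 < Nat.card G := Nat.card_pos
  have hm1 : m = 1 := by
    rcases Nat.lt_or_ge m 2 with h | h
    · interval_cases m
      · rw [hm, mul_zero] at hGpos; exact absurd hGpos (lt_irrefl 0)
      · rfl
    · exfalso
      have : 2 * Nat.card (K₁ × K₂ × K₃) ≤ Nat.card (K₁ × K₂ × K₃) * m := by
        rw [mul_comm]; exact Nat.mul_le_mul_left _ h
      omega
  have hcard : Nat.card (K₁ × K₂ × K₃) = Nat.card G := by rw [hm, hm1, mul_one]
  have hbij : Function.Bijective f := (Nat.bijective_iff_injective_and_card f).2 ⟨hf, hcard⟩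
  let e : K₁ × K₂ × K₃ ≃+ G := AddEquiv.ofBijective f hbij
  have he : ∀ x, e x = f x := fun x => rfl
  -- pull the family back along `e.symm`
  have hS' := hS.image (e.symm : G →+ K₁ × K₂ × K₃) e.symm.injective
  have back : ∀ P : Finset (K₁ × K₂ × K₃), (P.image f).image (e.symm : G →+ K₁ × K₂ × K₃) = P := by
    intro P
    rw [Finset.image_image]
    convert Finset.image_id (s := P) using 2
    funext x
    simp only [Function.comp_apply, AddMonoidHom.coe_coe, id_eq]
    rw [← he]; exact e.symm_apply_apply x
  have h := empty_of_isSTPP_contains_pair hK₁ hK₂ hK₃ hP₀ hP₁ hP₂ hS' hlj hlk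
    (by simp only [hAj, back]) (by simp only [hBj, back]) (by simp only [hCj, back])
    (by simp only [hAk, back]) (by simp only [hBk, back]) (by simp only [hCk, back])
  simp only [Finset.image_eq_empty] at h
  exact h

end Summit.MatrixMultiplication.MatrixMultiplication.Theorems.STPPPuncturedSubgroupsMaximal
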